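import Literature.Computability.QuantumComplexity.PauliPathStateEnumerator
import HarnessLib

/-!
# Two-point and tangent laws of the state enumerator `Ψ_C` and of the coherence enumerator `Ξ_C`:
fidelity, purity and the fidelity–XEB gap decay no faster than their MEAN PAULI DEGREE dictates

THESIS. `PauliPathStateEnumerator` records `F̄_γ = 2⁻ⁿ Ψ_C(1−γ)`, `P̄_γ = 2⁻ⁿ Ψ_C((1−γ)²)` and the split
`2ⁿ F̄_γ − (E_W XEB_γ + 1) = Ξ_C(1−γ)` with `Ψ_C(t) = Σ_k t^k V_k`, `Ξ_C(t) = Σ_k t^k Ξ_k`, `V_k, Ξ_k ≥ 0`. This file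
makes, on these two NEW objects, the SAME MOVE that `XEBMeanWeightExponentLaw` makes on the XEB tail `Φ_{>ℓ}`
(weighted AM–GM in the degree variable; nothing else is claimed as new): with the TILTED MEAN DEGREES
`κ̄(t) := Σ_k k t^k V_k / Ψ_C(t)` (`stateMeanDegree`) and `κ_Ξ(t) := Σ_k k t^k Ξ_k / Ξ_C(t)` (`cohMeanDegree`),
(T1) TWO-POINT LAWS for any layer matrices and `0 < t₁, t₂`: `Ψ_C(t₁)(t₂/t₁)^{κ̄(t₁)} ≤ Ψ_C(t₂) ≤ Ψ_C(t₁)(t₂/t₁)^{κ̄(t₂)}`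
and the same for `Ξ_C` (`stateEnumerator_mul_rpow_le`, `stateEnumerator_le_mul_rpow`, `cohEnumerator_mul_rpow_le`,
`cohEnumerator_le_mul_rpow`); (T2) based at `t₁ = 1`, unitary layers, `γ < 1`: `(1−γ)^{κ̄(1)} ≤ F̄_γ ≤ (1−γ)^{κ̄(1−γ)}`
(`rpow_le_avgFid`, `avgFid_le_rpow`), `((1−γ)²)^{κ̄(1)} ≤ P̄_γ` (`rpow_le_avgPurity`), and the GAP FLOOR
`(2ⁿ−1−α′)(1−γ)^{κ_Ξ(1)} ≤ 2ⁿ F̄_γ − (E_W XEB_γ + 1)` (`deficit_mul_rpow_le_gap`): the coherence the XEB does not see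
decays no faster than its own mean degree dictates; (T3) WINDOWS (unitary layers, `0 < t`):
`(d+1)(1 − 1/Ψ_C(t)) ≤ κ̄(t) ≤ n(d+1)(1 − 1/Ψ_C(t))` and `d+1 ≤ κ_Ξ(t) ≤ n(d+1)` whenever `Ξ_C(t) > 0`
(`stateMeanDegree_window`, `cohMeanDegree_window`), so at `t = 1`: `(d+1)(1−2⁻ⁿ) ≤ κ̄(1) ≤ n(d+1)(1−2⁻ⁿ)`; (T4) numbers.

HONEST FRAMING. Inequalities about the honest noisy circuit's OWN framed state in the tree's model (fixed layer
sequence, uniform Pauli frames, uniform depolarizing rate); «fidelity» = `Tr(σ̃_W(0) σ̃_W(γ))` with the ideal framed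
state as in the parent file — not any experiment's reported fidelity; no estimator, protocol or procedure; the
exponent `κ̄(1)` is a property of the IDEAL circuit's state spectrum and is NOT asserted to be computable or
measurable by anything here. The lever (weighted AM–GM, `Real.geom_mean_le_arith_mean_weighted`) and its XEB
version are the tree's (`PauliPath.avgXEB_zero_mul_rpow_le_avgXEB`); the ensemble reading `F ≈ e^{−(#errors)}` is
[cite: DalzellHunterJonesBrandao2021, eq. (14) and Theorem 1]. Nothing here bears on the complexity of sampling.
-/

noncomputable section

open Matrix Finset

namespace Literature.Computability.QuantumComplexity

namespace PauliPath.StateEnumerator.TangentFloor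

variable {ι : Type*} [Fintype ι] [DecidableEq ι] {d : ℕ}

/-- Two-point weighted AM–GM: for `c_k ≥ 0` with `Σ c_k t₁^k > 0` and `0 < t₁, t₂`,
`(Σ c_k t₁^k)·(t₂/t₁)^{(Σ k c_k t₁^k)/(Σ c_k t₁^k)} ≤ Σ c_k t₂^k`. [folklore] -/
private theorem twoPoint_amgm (s : Finset ℕ) (c : ℕ → ℝ) (hc : ∀ k ∈ s, 0 ≤ c k) {t₁ t₂ : ℝ}
    (h1 : 0 < t₁) (h2 : 0 < t₂) (hS : 0 < ∑ k ∈ s, t₁ ^ k * c k) :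
    (∑ k ∈ s, t₁ ^ k * c k) * (t₂ / t₁) ^ ((∑ k ∈ s, (k : ℝ) * (t₁ ^ k * c k)) / ∑ k ∈ s, t₁ ^ k * c k) ≤
      ∑ k ∈ s, t₂ ^ k * c k := by
  have hr : 0 < t₂ / t₁ := div_pos h2 h1
  have hw : ∀ k ∈ s, 0 ≤ t₁ ^ k * c k / ∑ j ∈ s, t₁ ^ j * c j :=
    fun k hk => div_nonneg (mul_nonneg (pow_nonneg h1.le k) (hc k hk)) hS.le
  have hw' : ∑ k ∈ s, t₁ ^ k * c k / ∑ j ∈ s, t₁ ^ j * c j = 1 := by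
    rw [← Finset.sum_div, div_self hS.ne']
  have hz : ∀ k ∈ s, 0 ≤ (t₂ / t₁) ^ k := fun k _ => pow_nonneg hr.le k
  have h := Real.geom_mean_le_arith_mean_weighted s (fun k => t₁ ^ k * c k / ∑ j ∈ s, t₁ ^ j * c j)
    (fun k => (t₂ / t₁) ^ k) hw hw' hz
  have hL : ∏ k ∈ s, ((t₂ / t₁) ^ k) ^ (t₁ ^ k * c k / ∑ j ∈ s, t₁ ^ j * c j) =
      (t₂ / t₁) ^ ((∑ k ∈ s, (k : ℝ) * (t₁ ^ k * c k)) / ∑ j ∈ s, t₁ ^ j * c j) := by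
    rw [Finset.sum_div, Real.rpow_sum_of_pos hr]
    refine Finset.prod_congr rfl fun k _ => ?_
    rw [← Real.rpow_natCast, ← Real.rpow_mul hr.le]
    congr 1
    ring
  have hR : ∑ k ∈ s, t₁ ^ k * c k / (∑ j ∈ s, t₁ ^ j * c j) * (t₂ / t₁) ^ k =
      (∑ k ∈ s, t₂ ^ k * c k) / ∑ j ∈ s, t₁ ^ j * c j := by
    rw [Finset.sum_div]
    refine Finset.sum_congr rfl fun k _ => ?_
    have ht : t₁ ^ k * (t₂ / t₁) ^ k = t₂ ^ k := by rw [← mul_pow, mul_div_cancel₀ _ h1.ne']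
    calc t₁ ^ k * c k / (∑ j ∈ s, t₁ ^ j * c j) * (t₂ / t₁) ^ k
        = (t₁ ^ k * (t₂ / t₁) ^ k) * c k / ∑ j ∈ s, t₁ ^ j * c j := by ring
      _ = t₂ ^ k * c k / ∑ j ∈ s, t₁ ^ j * c j := by rw [ht]
  rw [hL, hR, le_div_iff₀ hS] at h
  linarith

/-! ## Tilted mean degrees -/

/-- The degree-weighted state enumerator `Σ_k k t^k V_k` (numerator of `κ̄(t)`). [cite: AharonovEtAl2023, Definition 5 and §5] -/
def wStateEnum (t : ℝ) (U : Fin d → Matrix (ι → Bool) (ι → Bool) ℂ) (y : ι → Bool) : ℝ :=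
  ∑ k ∈ Finset.range (Fintype.card ι * (d + 1) + 1), (k : ℝ) * (t ^ k * stateWt U y k)

/-- The TILTED MEAN DEGREE of the state spectrum, `κ̄(t) := Σ_k k t^k V_k / Ψ_C(t)` (plain quotient; junk `0` when
`Ψ_C(t) = 0`, which cannot happen for unitary layers and `t ≥ 0`). [cite: DalzellHunterJonesBrandao2021, eq. (14)] -/
def stateMeanDegree (t : ℝ) (U : Fin d → Matrix (ι → Bool) (ι → Bool) ℂ) (y : ι → Bool) : ℝ :=
  wStateEnum t U y / stateEnumerator t U y

/-- The degree-weighted coherence enumerator `Σ_k k t^k Ξ_k`. [cite: GaoEtAl2024, §4.2] -/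
def wCohEnum (t : ℝ) (U : Fin d → Matrix (ι → Bool) (ι → Bool) ℂ) (y x₀ : ι → Bool) : ℝ :=
  ∑ k ∈ Finset.range (Fintype.card ι * (d + 1) + 1), (k : ℝ) * (t ^ k * cohWt U y x₀ k)

/-- The TILTED MEAN DEGREE of the coherence spectrum, `κ_Ξ(t) := Σ_k k t^k Ξ_k / Ξ_C(t)` (plain quotient, junk `0`
when `Ξ_C(t) = 0`, e.g. at `d = 0`). [cite: GaoEtAl2024, §4.2] -/
def cohMeanDegree (t : ℝ) (U : Fin d → Matrix (ι → Bool) (ι → Bool) ℂ) (y x₀ : ι → Bool) : ℝ :=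
  wCohEnum t U y x₀ / cohEnumerator t U y x₀

section AnyLayers

variable (U : Fin d → Matrix (ι → Bool) (ι → Bool) ℂ) (y x₀ : ι → Bool)

/-- `Ψ_C(t) ≥ 0` for `t ≥ 0`. [cite: AharonovEtAl2023, Definition 5] -/
theorem stateEnumerator_nonneg {t : ℝ} (ht : 0 ≤ t) : 0 ≤ stateEnumerator t U y :=
  Finset.sum_nonneg fun k _ => mul_nonneg (pow_nonneg ht k) (stateWt_nonneg U y k)

/-! ## (T1) two-point laws (any layer matrices, basis input, `0 < t₁, t₂`) -/

/-- **Two-point law for `Ψ_C`, floor**: `Ψ_C(t₁)·(t₂/t₁)^{κ̄(t₁)} ≤ Ψ_C(t₂)`. [cite: AharonovEtAl2023, §5; DalzellHunterJonesBrandao2021, eq. (14)] -/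
theorem stateEnumerator_mul_rpow_le {t₁ t₂ : ℝ} (h1 : 0 < t₁) (h2 : 0 < t₂) :
    stateEnumerator t₁ U y * (t₂ / t₁) ^ stateMeanDegree t₁ U y ≤ stateEnumerator t₂ U y := by
  rcases (stateEnumerator_nonneg U y h1.le).eq_or_lt with h0 | hpos
  · rw [← h0, zero_mul]; exact stateEnumerator_nonneg U y h2.le
  · exact twoPoint_amgm _ (stateWt U y) (fun k _ => stateWt_nonneg U y k) h1 h2 hpos

/-- **Two-point law for `Ψ_C`, ceiling**: `Ψ_C(t₂) ≤ Ψ_C(t₁)·(t₂/t₁)^{κ̄(t₂)}`. [cite: AharonovEtAl2023, §5; DalzellHunterJonesBrandao2021, eq. (14)] -/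
theorem stateEnumerator_le_mul_rpow {t₁ t₂ : ℝ} (h1 : 0 < t₁) (h2 : 0 < t₂) :
    stateEnumerator t₂ U y ≤ stateEnumerator t₁ U y * (t₂ / t₁) ^ stateMeanDegree t₂ U y := by
  have h := stateEnumerator_mul_rpow_le U y h2 h1
  have hρ : 0 < (t₂ / t₁) ^ stateMeanDegree t₂ U y := Real.rpow_pos_of_pos (div_pos h2 h1) _
  have hinv : (t₁ / t₂) ^ stateMeanDegree t₂ U y = ((t₂ / t₁) ^ stateMeanDegree t₂ U y)⁻¹ := by
    rw [← Real.inv_rpow (div_pos h2 h1).le, inv_div]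
  rwa [hinv, ← div_eq_mul_inv, div_le_iff₀ hρ] at h

/-- **Two-point law for `Ξ_C`, floor**: `Ξ_C(t₁)·(t₂/t₁)^{κ_Ξ(t₁)} ≤ Ξ_C(t₂)`. [cite: GaoEtAl2024, §4.2] -/
theorem cohEnumerator_mul_rpow_le {t₁ t₂ : ℝ} (h1 : 0 < t₁) (h2 : 0 < t₂) :
    cohEnumerator t₁ U y x₀ * (t₂ / t₁) ^ cohMeanDegree t₁ U y x₀ ≤ cohEnumerator t₂ U y x₀ := by
  rcases (cohEnumerator_nonneg U y x₀ h1.le).eq_or_lt with h0 | hpos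
  · rw [← h0, zero_mul]; exact cohEnumerator_nonneg U y x₀ h2.le
  · exact twoPoint_amgm _ (cohWt U y x₀) (fun k _ => cohWt_nonneg U y x₀ k) h1 h2 hpos

/-- **Two-point law for `Ξ_C`, ceiling**: `Ξ_C(t₂) ≤ Ξ_C(t₁)·(t₂/t₁)^{κ_Ξ(t₂)}`. [cite: GaoEtAl2024, §4.2] -/
theorem cohEnumerator_le_mul_rpow {t₁ t₂ : ℝ} (h1 : 0 < t₁) (h2 : 0 < t₂) :
    cohEnumerator t₂ U y x₀ ≤ cohEnumerator t₁ U y x₀ * (t₂ / t₁) ^ cohMeanDegree t₂ U y x₀ := by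
  have h := cohEnumerator_mul_rpow_le U y x₀ h2 h1
  have hρ : 0 < (t₂ / t₁) ^ cohMeanDegree t₂ U y x₀ := Real.rpow_pos_of_pos (div_pos h2 h1) _
  have hinv : (t₁ / t₂) ^ cohMeanDegree t₂ U y x₀ = ((t₂ / t₁) ^ cohMeanDegree t₂ U y x₀)⁻¹ := by
    rw [← Real.inv_rpow (div_pos h2 h1).le, inv_div]
  rwa [hinv, ← div_eq_mul_inv, div_le_iff₀ hρ] at h

end AnyLayers

section Unitary

variable {U : Fin d → Matrix (ι → Bool) (ι → Bool) ℂ} (hU : ∀ t, U t ∈ Matrix.unitaryGroup (ι → Bool) ℂ)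
  (y x₀ : ι → Bool)
include hU

/-! ## (T2) laws based at the ideal point `t = 1` (unitary layers) -/

/-- **FIDELITY FLOOR** `(1−γ)^{κ̄(1)} ≤ F̄_γ` (`γ < 1`): the frame-averaged fidelity decays no faster than the mean
Pauli degree of the IDEAL state spectrum dictates. [cite: DalzellHunterJonesBrandao2021, eq. (14) and Theorem 1] -/
theorem rpow_le_avgFid {γ : ℝ} (h1 : γ < 1) : (1 - γ) ^ stateMeanDegree 1 U y ≤ avgFid γ U y := by
  have h2 : (0 : ℝ) < (2 : ℝ) ^ Fintype.card ι := by positivity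
  have h := stateEnumerator_mul_rpow_le U y one_pos (sub_pos.2 h1)
  rw [div_one, stateEnumerator_one hU y] at h
  rw [avgFid_eq, le_inv_mul_iff₀ h2]
  exact h

/-- **FIDELITY CEILING** `F̄_γ ≤ (1−γ)^{κ̄(1−γ)}` (`γ < 1`, tilted exponent at the noisy point).
[cite: DalzellHunterJonesBrandao2021, eq. (14) and Theorem 1] -/
theorem avgFid_le_rpow {γ : ℝ} (h1 : γ < 1) : avgFid γ U y ≤ (1 - γ) ^ stateMeanDegree (1 - γ) U y := by
  have h2 : (0 : ℝ) < (2 : ℝ) ^ Fintype.card ι := by positivity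
  have h := stateEnumerator_le_mul_rpow U y one_pos (sub_pos.2 h1)
  rw [div_one, stateEnumerator_one hU y] at h
  rw [avgFid_eq, inv_mul_le_iff₀ h2]
  exact h

/-- **PURITY FLOOR** `((1−γ)²)^{κ̄(1)} ≤ P̄_γ` (`γ < 1`). [cite: DalzellHunterJonesBrandao2021, eq. (14)] -/
theorem rpow_le_avgPurity {γ : ℝ} (h1 : γ < 1) : ((1 - γ) ^ 2) ^ stateMeanDegree 1 U y ≤ avgPurity γ U y := by
  have h2 : (0 : ℝ) < (2 : ℝ) ^ Fintype.card ι := by positivity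
  have h := stateEnumerator_mul_rpow_le U y one_pos (t₂ := (1 - γ) ^ 2) (by nlinarith [sub_pos.2 h1])
  rw [div_one, stateEnumerator_one hU y] at h
  rw [avgPurity_eq, le_inv_mul_iff₀ h2]
  exact h

/-- **GAP FLOOR** `(2ⁿ − 1 − α′)·(1−γ)^{κ_Ξ(1)} ≤ 2ⁿ F̄_γ − (E_W XEB_γ + 1)` (`γ < 1`, `α′ = E_W XEB_0`): the coherence
invisible to the XEB decays no faster than ITS mean degree dictates. [cite: GaoEtAl2024, §4.2] -/
theorem deficit_mul_rpow_le_gap {γ : ℝ} (h1 : γ < 1) :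
    ((2 : ℝ) ^ Fintype.card ι - 1 - avgXEB 0 U y) * (1 - γ) ^ cohMeanDegree 1 U y x₀ ≤
      (2 : ℝ) ^ Fintype.card ι * avgFid γ U y - (avgXEB γ U y + 1) := by
  have h := cohEnumerator_mul_rpow_le U y x₀ one_pos (sub_pos.2 h1)
  rw [div_one, cohEnumerator_one hU y x₀] at h
  rw [two_pow_mul_avgFid_eq U y x₀ γ]
  linarith

/-! ## (T3) windows for the mean degrees (unitary layers: `V_0 = 1`, `V_k = Ξ_k = 0` for `0 < k ≤ d`) -/

/-- `(d+1)·(Ψ_C(t) − 1) ≤ Σ_k k t^k V_k ≤ n(d+1)·(Ψ_C(t) − 1)` for `0 ≤ t`. [cite: AharonovEtAl2023, Lemma 4 (items 1–2)] -/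
theorem wStateEnum_window {t : ℝ} (ht : 0 ≤ t) :
    ((d : ℝ) + 1) * (stateEnumerator t U y - 1) ≤ wStateEnum t U y ∧
      wStateEnum t U y ≤ (Fintype.card ι : ℝ) * ((d : ℝ) + 1) * (stateEnumerator t U y - 1) := by
  have hsplit : wStateEnum t U y =
      ∑ k ∈ (Finset.range (Fintype.card ι * (d + 1) + 1)).erase 0, (k : ℝ) * (t ^ k * stateWt U y k) := by
    rw [wStateEnum, ← Finset.add_sum_erase _ _ (Finset.mem_range.2 (Nat.succ_pos _))]
    simp
  have htail : stateEnumerator t U y - 1 =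
      ∑ k ∈ (Finset.range (Fintype.card ι * (d + 1) + 1)).erase 0, t ^ k * stateWt U y k := by
    rw [stateEnumerator_eq_one_add hU y t]; ring
  rw [hsplit, htail, Finset.mul_sum, Finset.mul_sum]
  refine ⟨Finset.sum_le_sum fun k hk => ?_, Finset.sum_le_sum fun k hk => ?_⟩
  · have hk0 : k ≠ 0 := (Finset.mem_erase.1 hk).1
    by_cases hkd : k ≤ d
    · rw [stateWt_eq_zero_of_le hU y hk0 hkd, mul_zero, mul_zero, mul_zero]
    · exact mul_le_mul_of_nonneg_right (by exact_mod_cast (by omega : d + 1 ≤ k))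
        (mul_nonneg (pow_nonneg ht k) (stateWt_nonneg U y k))
  · have hkN : k ≤ Fintype.card ι * (d + 1) :=
      Nat.lt_succ_iff.1 (Finset.mem_range.1 (Finset.mem_erase.1 hk).2)
    exact mul_le_mul_of_nonneg_right (by exact_mod_cast hkN)
      (mul_nonneg (pow_nonneg ht k) (stateWt_nonneg U y k))

/-- **WINDOW for `κ̄(t)`** (`0 < t`): `(d+1)(1 − 1/Ψ_C(t)) ≤ κ̄(t) ≤ n(d+1)(1 − 1/Ψ_C(t))`; at `t = 1`,
`(d+1)(1−2⁻ⁿ) ≤ κ̄(1) ≤ n(d+1)(1−2⁻ⁿ)`. [cite: AharonovEtAl2023, Lemma 4 (items 1–2) and Theorem 4 (the two exponents)] -/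
theorem stateMeanDegree_window {t : ℝ} (ht : 0 < t) :
    ((d : ℝ) + 1) * (1 - 1 / stateEnumerator t U y) ≤ stateMeanDegree t U y ∧
      stateMeanDegree t U y ≤ (Fintype.card ι : ℝ) * ((d : ℝ) + 1) * (1 - 1 / stateEnumerator t U y) := by
  have hΨ : 1 ≤ stateEnumerator t U y := by
    rw [stateEnumerator_eq_one_add hU y t]
    have : 0 ≤ ∑ k ∈ (Finset.range (Fintype.card ι * (d + 1) + 1)).erase 0, t ^ k * stateWt U y k :=
      Finset.sum_nonneg fun k _ => mul_nonneg (pow_nonneg ht.le k) (stateWt_nonneg U y k)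
    linarith
  have hΨpos : 0 < stateEnumerator t U y := by linarith
  have h := wStateEnum_window hU y ht.le
  have hq : 1 - 1 / stateEnumerator t U y = (stateEnumerator t U y - 1) / stateEnumerator t U y := by
    field_simp
  rw [hq, stateMeanDegree]
  constructor
  · rw [← mul_div_assoc, div_le_div_iff_of_pos_right hΨpos]; exact h.1
  · rw [← mul_div_assoc, div_le_div_iff_of_pos_right hΨpos]; exact h.2

/-- **WINDOW for `κ_Ξ(t)`** (`0 ≤ t`, `Ξ_C(t) > 0`): `d + 1 ≤ κ_Ξ(t) ≤ n(d+1)` — every coherence path has degree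
between the light cone `d+1` and the number of locations. [cite: AharonovEtAl2023, Lemma 4 and Theorem 4; GaoEtAl2024, §4.2] -/
theorem cohMeanDegree_window {t : ℝ} (ht : 0 ≤ t) (hpos : 0 < cohEnumerator t U y x₀) :
    (d : ℝ) + 1 ≤ cohMeanDegree t U y x₀ ∧ cohMeanDegree t U y x₀ ≤ (Fintype.card ι : ℝ) * ((d : ℝ) + 1) := by
  have hsplit : wCohEnum t U y x₀ =
      ∑ k ∈ (Finset.range (Fintype.card ι * (d + 1) + 1)).erase 0, (k : ℝ) * (t ^ k * cohWt U y x₀ k) := by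
    rw [wCohEnum, ← Finset.add_sum_erase _ _ (Finset.mem_range.2 (Nat.succ_pos _))]
    simp
  have hw : ((d : ℝ) + 1) * cohEnumerator t U y x₀ ≤ wCohEnum t U y x₀ ∧
      wCohEnum t U y x₀ ≤ (Fintype.card ι : ℝ) * ((d : ℝ) + 1) * cohEnumerator t U y x₀ := by
    rw [hsplit, cohEnumerator_eq_sum_erase hU y x₀ t, Finset.mul_sum, Finset.mul_sum]
    refine ⟨Finset.sum_le_sum fun k hk => ?_, Finset.sum_le_sum fun k hk => ?_⟩
    · have hk0 : k ≠ 0 := (Finset.mem_erase.1 hk).1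
      by_cases hkd : k ≤ d
      · rw [cohWt_eq_zero_of_le hU y x₀ hkd, mul_zero, mul_zero, mul_zero]
      · exact mul_le_mul_of_nonneg_right (by exact_mod_cast (by omega : d + 1 ≤ k))
          (mul_nonneg (pow_nonneg ht k) (cohWt_nonneg U y x₀ k))
    · have hkN : k ≤ Fintype.card ι * (d + 1) :=
        Nat.lt_succ_iff.1 (Finset.mem_range.1 (Finset.mem_erase.1 hk).2)
      exact mul_le_mul_of_nonneg_right (by exact_mod_cast hkN)
        (mul_nonneg (pow_nonneg ht k) (cohWt_nonneg U y x₀ k))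
  rw [cohMeanDegree]
  exact ⟨(le_div_iff₀ hpos).2 hw.1, (div_le_iff₀ hpos).2 hw.2⟩

end Unitary

/-- Numbers at `n = 53`, `d + 1 = 20`, `γ = 1/200`: the window is `20(1−2⁻⁵³) ≤ κ̄(1) ≤ 1060(1−2⁻⁵³)`; at the
light-cone end the floor `(1−γ)^{κ̄(1)}` is `> 0.9046`, at the all-locations end `< 0.9047^{53} < 1/200`, and `κ̄(1) ≤ 138` keeps the
frame-averaged fidelity floor above `1/2` (`(1−1/200)^{138} > 1/2 > (1−1/200)^{139}`). VACUITY: the floor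
`(1−γ)^{κ̄(1)}` is informative only when `κ̄(1)` sits near the light-cone end of its window; nothing here says where a
given circuit's `κ̄(1)` sits, and `n = 53`, `20` cycles are merely the parameters printed in [cite: AruteEtAl2019, Fig. 4]
(the rate `1/200` is illustrative, not a reported error budget). -/
theorem numbers : (0.9046 : ℝ) < (1 - 1 / 200) ^ 20 ∧ ((1 : ℝ) - 1 / 200) ^ 20 < 0.9047 ∧
    (0.9047 : ℝ) ^ 53 < 1 / 200 ∧ (1 / 2 : ℝ) < (1 - 1 / 200) ^ 138 ∧ ((1 : ℝ) - 1 / 200) ^ 139 < 1 / 2 := by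
  norm_num

end PauliPath.StateEnumerator.TangentFloor

end Literature.Computability.QuantumComplexity
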